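import Summits.QuantumFields.YangMills.Theorems.LuscherReductionTwistedTraceScalingBOCentralRatesEight
import HarnessLib

/-!
# (B-O) central tube — ★★ THE RATE: `hi₀/lo₀ ≤ 1 + β^{-1/5}` eventually (schedule B, repaired smearing window)

Quantitative twin of `…BOCentralRatesFive.central_ratio_record` for the bound of record `…BOCentralRecordTwo.central_transfer_record_two`
(smearing action ceiling `β^{-1/2}`): with `lo₀, hi₀` the `v'`-independent factors of its two bounds, EVENTUALLY IN `β`,
`0 < lo₀(β)` and `hi₀(β) ≤ (1 + β^{-1/5})·lo₀(β)`.  Hence the central quasimode error `η_c(β) ≤ β^{-1/5}`, and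
`η_c² = β^{-2/5} = o(λ_b(L³β))` as `BOBricks.hb_small` demands (next file `…BOCentralQuasimodeRate`).
Proof: every factor `f` of `lo₀/N`, `hi₀/N` (`N = e^{2β|E|}(2π²)^{-|E|}fpZ·N̄`) has `(f−1)·β^{1/5} → 0` and every tail `t` has `t·β^{1/5} → 0`
(`…BOCentralRatesSeven/Eight`), so `(hi₀/N − lo₀/N)·β^{1/5} → 0` (§1 `weighted_lo`, `weighted_hi`) while `lo₀/N → 1`; §2 the endgame.
HONEST FRAMING: the (C1) RATE; (C4), (C5), (B-ST), C4-CORE OPEN; stub of a child of the CONDITIONAL route R2b1; not a gap, not Clay.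
-/

open MeasureTheory Filter Topology Real
open scoped BigOperators
open Literature.MathematicalPhysics.QuantumFieldTheory
open Literature.MathematicalPhysics.QuantumLattice

namespace Summit.QuantumFields.YangMills.Theorems.FemtoTransferGap.TwoLattice.ConstTube

open Summit.QuantumFields.YangMills.Theorems.FemtoTransferGap
open Summit.QuantumFields.YangMills.Theorems.FemtoTransferGap.TwoLattice
open Summit.QuantumFields.YangMills.Theorems.FemtoTransferGap.TwoLattice.Stiff

variable {L : ℕ} [NeZero L]

/-! ## §0 Two transports and the real-number endgame -/

/-- Transport of a weighted pair along an eventual equality. [folklore] -/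
theorem wt_congr {f g W : ℝ → ℝ} (hf : Tendsto (fun β => (f β - 1) * W β) atTop (𝓝 0) ∧ Tendsto f atTop (𝓝 1))
    (h : ∀ᶠ β : ℝ in atTop, f β = g β) :
    Tendsto (fun β => (g β - 1) * W β) atTop (𝓝 0) ∧ Tendsto g atTop (𝓝 1) :=
  ⟨hf.1.congr' (h.mono fun β hβ => by rw [hβ]), hf.2.congr' h⟩

/-- Transport of a weighted tail along an eventual equality. [folklore] -/
theorem zt_congr {t s W : ℝ → ℝ} (ht : Tendsto (fun β => t β * W β) atTop (𝓝 0) ∧ Tendsto t atTop (𝓝 0))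
    (h : ∀ᶠ β : ℝ in atTop, t β = s β) :
    Tendsto (fun β => s β * W β) atTop (𝓝 0) ∧ Tendsto s atTop (𝓝 0) :=
  ⟨ht.1.congr' (h.mono fun β hβ => by rw [hβ]), ht.2.congr' h⟩

/-- ★ **The real-number endgame of the rate**: `N > 0`, `lo/N > 1/2`, `(hi/N − lo/N)·W < 1/2`, `w₅·W = 1`, `w₅ > 0` ⇒ `0 < lo` and `hi ≤ (1 + w₅)·lo`. [folklore] -/
theorem ratio_rate_of_weighted {lo hi N w5 W : ℝ} (hN : 0 < N) (h1 : 1 / 2 < lo / N) (h2 : (hi / N - lo / N) * W < 1 / 2) (hW : w5 * W = 1)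
    (h5 : 0 < w5) : 0 < lo ∧ hi ≤ (1 + w5) * lo := by
  have hlo : 0 < lo := by
    have : 0 < lo / N := lt_trans (by norm_num) h1
    exact (div_pos_iff_of_pos_right hN).1 this
  refine ⟨hlo, ?_⟩
  have hW0 : 0 < W := by
    rcases lt_or_ge 0 W with h | h
    · exact h
    · nlinarith
  have hA : (hi / N - lo / N) * W ≤ lo / N := by linarith
  have h3 : hi / N - lo / N ≤ w5 * (lo / N) := by
    have hB := mul_le_mul_of_nonneg_left hA h5.le
    calc hi / N - lo / N = w5 * ((hi / N - lo / N) * W) := by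
          rw [mul_comm (hi / N - lo / N) W, ← mul_assoc, hW, one_mul]
      _ ≤ w5 * (lo / N) := hB
  have h4 : hi / N ≤ (1 + w5) * lo / N := by rw [mul_div_assoc]; linarith
  exact (div_le_div_iff_of_pos_right hN).1 h4

/-! ## §1 The weighted deviations of `lo₀/N` and `hi₀/N` -/

set_option maxHeartbeats 1600000 in
-- the statement displays the ~4k-character lower bound of record verbatim; elaboration and the closing `ring` identity exceed the default budget.
/-- ★ `lo₀/N → 1` at rate `o(β^{-1/5})`: `(lo₀/N − 1)·β^{1/5} → 0` and `lo₀/N → 1` (repaired smearing window, schedule B). [folklore] -/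
theorem weighted_lo (Ksp MT KD B CL Cp : ℝ) :
    Tendsto (fun β : ℝ => ((Real.exp (-(coreEta L β 0 (powScale (1 / 3) β) (9 * (L : ℝ) * (5 * (powScale (1 / 2) β * btLog β ^ 2)) + (powScale 1 β)) (min (1 / 40) (powScale (1 / 2) β * btLog β)) ((powScale 1 β) * Fintype.card (Site 3 L)) (powScale (1 / 2) β) + coreEps1 L β 0 (9 * (L : ℝ) * (5 * (powScale (1 / 2) β * btLog β ^ 2)) + (powScale 1 β)) (min (1 / 40) (powScale (1 / 2) β * btLog β)) + coreEps2 L β 0 (9 * (L : ℝ) * (5 * (powScale (1 / 2) β * btLog β ^ 2)) + (powScale 1 β)) (min (1 / 40) (powScale (1 / 2) β * btLog β)) (powScale (1 / 2) β))) *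
          (1 * (Real.exp (2 * β) ^ Fintype.card (Edge 3 L) * ((2 * π ^ 2)⁻¹ * ((1 + (8 * (9 * (L : ℝ) * (5 * (powScale (1 / 2) β * btLog β ^ 2)) + (powScale 1 β))) ^ 2)⁻¹) ^ 2) ^ Fintype.card (Edge 3 L) *
              Real.exp (-(2000 * Fintype.card (Plaquette 3 L) * (8 * (9 * (L : ℝ) * (5 * (powScale (1 / 2) β * btLog β ^ 2)) + (powScale 1 β))) ^ 3 * β)) * (fpZ (powScale 1 β) * ((1:ℝ) * Real.exp (-(((96 * (β / 2) + (β)) * (B * (powScale 1 β * btLog β ^ 3) + MT * (powScale 1 β * btLog β ^ 3) ^ 2) * (2 * ((((min (1 / 40) (powScale (1 / 2) β * btLog β)) / 12) + (9 / 10 * (min (1 / 40) (powScale (1 / 2) β * btLog β)))) + 14 * ((Fintype.card (Edge 3 L) : ℝ)) * (8 * (9 * (L : ℝ) * (5 * (powScale (1 / 2) β * btLog β ^ 2)) + (powScale 1 β))) ^ 2 + (CL * ((4 + 48 * Ksp) * (8 * (9 * (L : ℝ) * (5 * (powScale (1 / 2) β * btLog β ^ 2)) + (powScale 1 β)))) *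 (9 * Ksp * (8 * (9 * (L : ℝ) * (5 * (powScale (1 / 2) β * btLog β ^ 2)) + (powScale 1 β)))) + MT * (9 * Ksp * (8 * (9 * (L : ℝ) * (5 * (powScale (1 / 2) β * btLog β ^ 2)) + (powScale 1 β)))) ^ 2)) + (B * (powScale 1 β * btLog β ^ 3) + MT * (powScale 1 β * btLog β ^ 3) ^ 2))) + ((96 * (β / 2) + (β)) * ((CL * ((4 + 48 * Ksp) * (8 * (9 * (L : ℝ) * (5 * (powScale (1 / 2) β * btLog β ^ 2)) + (powScale 1 β)))) * (9 * Ksp * (8 * (9 * (L : ℝ) * (5 * (powScale (1 / 2) β * btLog β ^ 2)) + (powScale 1 β)))) + MT * (9 * Ksp * (8 * (9 * (L : ℝ) * (5 * (powScale (1 / 2) β * btLog β ^ 2)) + (powScale 1 β)))) ^ 2) * (2 * ((((min (1 / 40) (powScale (1 / 2) β * btLog β)) / 12) + (9 / 10 * (min (1 / 40) (powScale (1 / 2) β * btLog β)))) + 14 * ((Fintype.card (Edge 3 L) : ℝ)) * (8 * (9 * (L : ℝ) * (5 * (powScale (1 / 2) β * btLog β ^ 2)) + (powScale 1 β))) ^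 2 + (CL * ((4 + 48 * Ksp) * (8 * (9 * (L : ℝ) * (5 * (powScale (1 / 2) β * btLog β ^ 2)) + (powScale 1 β)))) * (9 * Ksp * (8 * (9 * (L : ℝ) * (5 * (powScale (1 / 2) β * btLog β ^ 2)) + (powScale 1 β)))) + MT * (9 * Ksp * (8 * (9 * (L : ℝ) * (5 * (powScale (1 / 2) β * btLog β ^ 2)) + (powScale 1 β)))) ^ 2)) + (CL * ((4 + 48 * Ksp) * (8 * (9 * (L : ℝ) * (5 * (powScale (1 / 2) β * btLog β ^ 2)) + (powScale 1 β)))) * (9 * Ksp * (8 * (9 * (L : ℝ) * (5 * (powScale (1 / 2) β * btLog β ^ 2)) + (powScale 1 β)))) + MT * (9 * Ksp * (8 * (9 * (L : ℝ) * (5 * (powScale (1 / 2) β * btLog β ^ 2)) + (powScale 1 β)))) ^ 2)) + 72 * ((Fintype.card (Edge 3 L) : ℝ)) * (8 * (9 * (L : ℝ) * (5 * (powScale (1 / 2) β * btLog β ^ 2)) + (powScale 1 β))) ^ 3)))) * ((fpWeightBar L (powScale 1 β) * (1 - Cp * (1 * powScale (1 / 4) β) ^ 2)) - ((1 + KD *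 ((4 + 48 * Ksp) * (8 * (9 * (L : ℝ) * (5 * (powScale (1 / 2) β * btLog β ^ 2)) + (powScale 1 β)))) ^ 2) * (4 : ℝ) ^ (flatDim L / 2 : ℝ) * Real.exp (-((1 / (4 * sliceConst L)) ^ 2 * (powScale 1 β * btLog β ^ 3) ^ 2 / (4 * (powScale 1 β) ^ 2))) * fpWeightBar L (powScale 1 β))))) *
            (Real.exp (-(882 * β * (9 * (L : ℝ) * (5 * (powScale (1 / 2) β * btLog β ^ 2)) + (powScale 1 β)) ^ 2 * ((min (1 / 40) (powScale (1 / 2) β * btLog β)) / 12) ^ 2)) -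
              Real.exp (49 * β * ((min (1 / 40) (powScale (1 / 2) β * btLog β)) / 12) ^ 2) * (Real.exp (-(β * (min ((8 * (9 * (L : ℝ) * (5 * (powScale (1 / 2) β * btLog β ^ 2)) + (powScale 1 β))) - 2 * (9 * (L : ℝ) * (5 * (powScale (1 / 2) β * btLog β ^ 2)) + (powScale 1 β))) ((9 / 10 * (min (1 / 40) (powScale (1 / 2) β * btLog β))) - 6 * (9 * (L : ℝ) * (5 * (powScale (1 / 2) β * btLog β ^ 2)) + (powScale 1 β)) ^ 2 * ((min (1 / 40) (powScale (1 / 2) β * btLog β)) / 12))) ^ 2 / 2)) * (π / (β / 2)) ^ ((Module.finrank ℝ (LinkSpace L) : ℝ) / 2)) /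
                stiffGaussTop L (β / 2) β)))) / (Real.exp (2 * β) ^ Fintype.card (Edge 3 L) * ((2 * π ^ 2)⁻¹) ^ Fintype.card (Edge 3 L) * fpZ (powScale 1 β) * fpWeightBar L (powScale 1 β)) - 1) * powScale (-(1 / 5)) β) atTop (𝓝 0) ∧
      Tendsto (fun β : ℝ => (Real.exp (-(coreEta L β 0 (powScale (1 / 3) β) (9 * (L : ℝ) * (5 * (powScale (1 / 2) β * btLog β ^ 2)) + (powScale 1 β)) (min (1 / 40) (powScale (1 / 2) β * btLog β)) ((powScale 1 β) * Fintype.card (Site 3 L)) (powScale (1 / 2) β) + coreEps1 L β 0 (9 * (L : ℝ) * (5 * (powScale (1 / 2) β * btLog β ^ 2)) + (powScale 1 β)) (min (1 / 40) (powScale (1 / 2) β * btLog β)) + coreEps2 L β 0 (9 * (L : ℝ) * (5 * (powScale (1 / 2) β * btLog β ^ 2)) + (powScale 1 β)) (min (1 / 40) (powScale (1 / 2) β * btLog β)) (powScale (1 / 2) β))) *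
          (1 * (Real.exp (2 * β) ^ Fintype.card (Edge 3 L) * ((2 * π ^ 2)⁻¹ * ((1 + (8 * (9 * (L : ℝ) * (5 * (powScale (1 / 2) β * btLog β ^ 2)) + (powScale 1 β))) ^ 2)⁻¹) ^ 2) ^ Fintype.card (Edge 3 L) *
              Real.exp (-(2000 * Fintype.card (Plaquette 3 L) * (8 * (9 * (L : ℝ) * (5 * (powScale (1 / 2) β * btLog β ^ 2)) + (powScale 1 β))) ^ 3 * β)) * (fpZ (powScale 1 β) * ((1:ℝ) * Real.exp (-(((96 * (β / 2) + (β)) * (B * (powScale 1 β * btLog β ^ 3) + MT * (powScale 1 β * btLog β ^ 3) ^ 2) * (2 * ((((min (1 / 40) (powScale (1 / 2) β * btLog β)) / 12) + (9 / 10 * (min (1 / 40) (powScale (1 / 2) β * btLog β)))) + 14 * ((Fintype.card (Edge 3 L) : ℝ)) * (8 * (9 * (L : ℝ) * (5 * (powScale (1 / 2) β * btLog β ^ 2)) + (powScale 1 β))) ^ 2 + (CL * ((4 + 48 * Ksp) * (8 * (9 * (L : ℝ) * (5 * (powScale (1 / 2) β * btLog β ^ 2)) + (powScale 1 β)))) *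 (9 * Ksp * (8 * (9 * (L : ℝ) * (5 * (powScale (1 / 2) β * btLog β ^ 2)) + (powScale 1 β)))) + MT * (9 * Ksp * (8 * (9 * (L : ℝ) * (5 * (powScale (1 / 2) β * btLog β ^ 2)) + (powScale 1 β)))) ^ 2)) + (B * (powScale 1 β * btLog β ^ 3) + MT * (powScale 1 β * btLog β ^ 3) ^ 2))) + ((96 * (β / 2) + (β)) * ((CL * ((4 + 48 * Ksp) * (8 * (9 * (L : ℝ) * (5 * (powScale (1 / 2) β * btLog β ^ 2)) + (powScale 1 β)))) * (9 * Ksp * (8 * (9 * (L : ℝ) * (5 * (powScale (1 / 2) β * btLog β ^ 2)) + (powScale 1 β)))) + MT * (9 * Ksp * (8 * (9 * (L : ℝ) * (5 * (powScale (1 / 2) β * btLog β ^ 2)) + (powScale 1 β)))) ^ 2) * (2 * ((((min (1 / 40) (powScale (1 / 2) β * btLog β)) / 12) + (9 / 10 * (min (1 / 40) (powScale (1 / 2) β * btLog β)))) + 14 * ((Fintype.card (Edge 3 L) : ℝ)) * (8 * (9 * (L : ℝ) * (5 * (powScale (1 / 2) β * btLog β ^ 2)) + (powScale 1 β))) ^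 2 + (CL * ((4 + 48 * Ksp) * (8 * (9 * (L : ℝ) * (5 * (powScale (1 / 2) β * btLog β ^ 2)) + (powScale 1 β)))) * (9 * Ksp * (8 * (9 * (L : ℝ) * (5 * (powScale (1 / 2) β * btLog β ^ 2)) + (powScale 1 β)))) + MT * (9 * Ksp * (8 * (9 * (L : ℝ) * (5 * (powScale (1 / 2) β * btLog β ^ 2)) + (powScale 1 β)))) ^ 2)) + (CL * ((4 + 48 * Ksp) * (8 * (9 * (L : ℝ) * (5 * (powScale (1 / 2) β * btLog β ^ 2)) + (powScale 1 β)))) * (9 * Ksp * (8 * (9 * (L : ℝ) * (5 * (powScale (1 / 2) β * btLog β ^ 2)) + (powScale 1 β)))) + MT * (9 * Ksp * (8 * (9 * (L : ℝ) * (5 * (powScale (1 / 2) β * btLog β ^ 2)) + (powScale 1 β)))) ^ 2)) + 72 * ((Fintype.card (Edge 3 L) : ℝ)) * (8 * (9 * (L : ℝ) * (5 * (powScale (1 / 2) β * btLog β ^ 2)) + (powScale 1 β))) ^ 3)))) * ((fpWeightBar L (powScale 1 β) * (1 - Cp * (1 * powScale (1 / 4) β) ^ 2)) - ((1 + KD *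 ((4 + 48 * Ksp) * (8 * (9 * (L : ℝ) * (5 * (powScale (1 / 2) β * btLog β ^ 2)) + (powScale 1 β)))) ^ 2) * (4 : ℝ) ^ (flatDim L / 2 : ℝ) * Real.exp (-((1 / (4 * sliceConst L)) ^ 2 * (powScale 1 β * btLog β ^ 3) ^ 2 / (4 * (powScale 1 β) ^ 2))) * fpWeightBar L (powScale 1 β))))) *
            (Real.exp (-(882 * β * (9 * (L : ℝ) * (5 * (powScale (1 / 2) β * btLog β ^ 2)) + (powScale 1 β)) ^ 2 * ((min (1 / 40) (powScale (1 / 2) β * btLog β)) / 12) ^ 2)) -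
              Real.exp (49 * β * ((min (1 / 40) (powScale (1 / 2) β * btLog β)) / 12) ^ 2) * (Real.exp (-(β * (min ((8 * (9 * (L : ℝ) * (5 * (powScale (1 / 2) β * btLog β ^ 2)) + (powScale 1 β))) - 2 * (9 * (L : ℝ) * (5 * (powScale (1 / 2) β * btLog β ^ 2)) + (powScale 1 β))) ((9 / 10 * (min (1 / 40) (powScale (1 / 2) β * btLog β))) - 6 * (9 * (L : ℝ) * (5 * (powScale (1 / 2) β * btLog β ^ 2)) + (powScale 1 β)) ^ 2 * ((min (1 / 40) (powScale (1 / 2) β * btLog β)) / 12))) ^ 2 / 2)) * (π / (β / 2)) ^ ((Module.finrank ℝ (LinkSpace L) : ℝ) / 2)) /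
                stiffGaussTop L (β / 2) β)))) / (Real.exp (2 * β) ^ Fintype.card (Edge 3 L) * ((2 * π ^ 2)⁻¹) ^ Fintype.card (Edge 3 L) * fpZ (powScale 1 β) * fpWeightBar L (powScale 1 β))) atTop (𝓝 1) := by
  have hNpos : ∀ β : ℝ, 0 < (Real.exp (2 * β) ^ Fintype.card (Edge 3 L) * ((2 * π ^ 2)⁻¹) ^ Fintype.card (Edge 3 L) * fpZ (powScale 1 β) * fpWeightBar L (powScale 1 β)) := fun β => by
    have := fpZ_pos (powScale_pos 1 β); have := fpWeightBar_pos (L := L) (powScale_pos 1 β); positivity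
  have hsplit : ∀ β : ℝ, ((2 * π ^ 2)⁻¹ * ((1 + (8 * (9 * (L : ℝ) * (5 * (powScale (1 / 2) β * btLog β ^ 2)) + powScale 1 β)) ^ 2)⁻¹) ^ 2) ^ Fintype.card (Edge 3 L) =
      ((2 * π ^ 2)⁻¹) ^ Fintype.card (Edge 3 L) * (((1 + (8 * (9 * (L : ℝ) * (5 * (powScale (1 / 2) β * btLog β ^ 2)) + powScale 1 β)) ^ 2)⁻¹) ^ 2) ^ Fintype.card (Edge 3 L) := fun β => mul_pow _ _ _
  have pX := zt_smearing (L := L)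
  have eXm := wt_exp_neg pX.1 pX.2
  have pcurv := wt_pow (wt_pow (wt_inv (wt_one_add (zt_rho_sq (L := L)))) 2) (Fintype.card (Edge 3 L))
  have hG : Tendsto (fun β : ℝ => 2000 * Fintype.card (Plaquette 3 L) * (8 * (9 * (L : ℝ) * (5 * (powScale (1 / 2) β * btLog β ^ 2)) + powScale 1 β)) ^ 3 * β * powScale (-(1 / 5)) β) atTop (𝓝 0) ∧
      Tendsto (fun β : ℝ => 2000 * Fintype.card (Plaquette 3 L) * (8 * (9 * (L : ℝ) * (5 * (powScale (1 / 2) β * btLog β ^ 2)) + powScale 1 β)) ^ 3 * β) atTop (𝓝 0) := by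
    have h := zt_const_mul (2000 * (Fintype.card (Plaquette 3 L) : ℝ)) (zt_beta_rho_cube (L := L))
    exact ⟨h.1.congr' (Eventually.of_forall fun β => by ring), h.2.congr' (Eventually.of_forall fun β => by ring)⟩
  have tGm := wt_exp_neg hG.1 hG.2
  have eDm := wt_exp_neg (zt_transport_defects (L := L) Ksp MT B CL).1 (tendsto_transport_defects (L := L) Ksp MT B CL).1
  have tdm := wt_one_sub (zt_defect Cp)
  have tTb := zt_sliceTail (L := L) KD Ksp
  have hloc := zt_loc (L := L)
  have tE1m := wt_exp_neg hloc.1 hloc.2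
  have tTail := zt_gaussTail (L := L)
  have pflo := wt_mul (wt_mul (wt_mul (wt_mul (wt_mul eXm pcurv) tGm) eDm) (wt_sub_tail tdm tTb)) (wt_sub_tail tE1m tTail)
  refine wt_congr pflo ?_
  filter_upwards [eventually_ge_atTop (1 : ℝ)] with β hβ
  rw [eq_div_iff (hNpos β).ne', hsplit β]
  ring

set_option maxHeartbeats 1600000 in
-- the statement displays the ~4k-character upper bound of record verbatim; elaboration and the closing `ring` identity exceed the default budget.
/-- ★ `hi₀/N → 1` at rate `o(β^{-1/5})`: `(hi₀/N − 1)·β^{1/5} → 0` and `hi₀/N → 1` (repaired smearing window, schedule B). [folklore] -/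
theorem weighted_hi (Ksp MT KD B CL Cp : ℝ) :
    Tendsto (fun β : ℝ => ((Real.exp (coreEta L β 0 (powScale (1 / 3) β) (9 * (L : ℝ) * (5 * (powScale (1 / 2) β * btLog β ^ 2)) + (powScale 1 β)) (min (1 / 40) (powScale (1 / 2) β * btLog β)) ((powScale 1 β) * Fintype.card (Site 3 L)) (powScale (1 / 2) β) + coreEps1 L β 0 (9 * (L : ℝ) * (5 * (powScale (1 / 2) β * btLog β ^ 2)) + (powScale 1 β)) (min (1 / 40) (powScale (1 / 2) β * btLog β)) + coreEps2 L β 0 (9 * (L : ℝ) * (5 * (powScale (1 / 2) β * btLog β ^ 2)) + (powScale 1 β)) (min (1 / 40) (powScale (1 / 2) β * btLog β)) (powScale (1 / 2) β)) *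
          (1 * (Real.exp (2 * β) ^ Fintype.card (Edge 3 L) * ((2 * π ^ 2)⁻¹) ^ Fintype.card (Edge 3 L) * Real.exp (2000 * Fintype.card (Plaquette 3 L) * (8 * (9 * (L : ℝ) * (5 * (powScale (1 / 2) β * btLog β ^ 2)) + (powScale 1 β))) ^ 3 * β) *
                Real.exp (8 * Fintype.card (Edge 3 L) * β * (8 * (9 * (L : ℝ) * (5 * (powScale (1 / 2) β * btLog β ^ 2)) + (powScale 1 β))) ^ 4) * (fpZ (powScale 1 β) * (1:ℝ) * (Real.exp (((96 * (β / 2) + (β)) * (B * (powScale 1 β * btLog β ^ 3) + MT * (powScale 1 β * btLog β ^ 3) ^ 2) * (2 * (Real.sqrt ((Fintype.card (Edge 3 L) : ℝ)) * (8 * (9 * (L : ℝ) * (5 * (powScale (1 / 2) β * btLog β ^ 2)) + (powScale 1 β))) + (7 * ((Fintype.card (Edge 3 L) : ℝ)) * (8 * (9 * (L : ℝ) * (5 * (powScale (1 / 2) β * btLog β ^ 2)) + (powScale 1 β))) + B * (9 * Ksp * (8 * (9 * (L : ℝ) * (5 * (powScale (1 / 2) β * btLog β ^ 2)) + (powScale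 1 β)))) + MT * (9 * Ksp * (8 * (9 * (L : ℝ) * (5 * (powScale (1 / 2) β * btLog β ^ 2)) + (powScale 1 β)))) ^ 2)) + (B * (powScale 1 β * btLog β ^ 3) + MT * (powScale 1 β * btLog β ^ 3) ^ 2))) + ((96 * (β / 2) + (β)) * ((CL * ((4 + 48 * Ksp) * (8 * (9 * (L : ℝ) * (5 * (powScale (1 / 2) β * btLog β ^ 2)) + (powScale 1 β)))) * (9 * Ksp * (8 * (9 * (L : ℝ) * (5 * (powScale (1 / 2) β * btLog β ^ 2)) + (powScale 1 β)))) + MT * (9 * Ksp * (8 * (9 * (L : ℝ) * (5 * (powScale (1 / 2) β * btLog β ^ 2)) + (powScale 1 β)))) ^ 2) * (2 * (Real.sqrt ((Fintype.card (Edge 3 L) : ℝ)) * (8 * (9 * (L : ℝ) * (5 * (powScale (1 / 2) β * btLog β ^ 2)) + (powScale 1 β))) + (7 * ((Fintype.card (Edge 3 L) : ℝ)) * (8 * (9 * (L : ℝ) * (5 * (powScale (1 / 2) β * btLog β ^ 2)) + (powScale 1 β))) + B * (9 * Ksp * (8 * (9 * (L : ℝ) * (5 * (powScale (1 / 2) β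 * btLog β ^ 2)) + (powScale 1 β)))) + MT * (9 * Ksp * (8 * (9 * (L : ℝ) * (5 * (powScale (1 / 2) β * btLog β ^ 2)) + (powScale 1 β)))) ^ 2)) + (CL * ((4 + 48 * Ksp) * (8 * (9 * (L : ℝ) * (5 * (powScale (1 / 2) β * btLog β ^ 2)) + (powScale 1 β)))) * (9 * Ksp * (8 * (9 * (L : ℝ) * (5 * (powScale (1 / 2) β * btLog β ^ 2)) + (powScale 1 β)))) + MT * (9 * Ksp * (8 * (9 * (L : ℝ) * (5 * (powScale (1 / 2) β * btLog β ^ 2)) + (powScale 1 β)))) ^ 2)) + 72 * ((Fintype.card (Edge 3 L) : ℝ)) * (8 * (9 * (L : ℝ) * (5 * (powScale (1 / 2) β * btLog β ^ 2)) + (powScale 1 β))) ^ 3))) * (fpWeightBar L (powScale 1 β) * (1 + Cp * (1 * powScale (1 / 4) β) ^ 2)) + ((1 + KD * ((4 + 48 * Ksp) * (8 * (9 * (L : ℝ) * (5 * (powScale (1 / 2) β * btLog β ^ 2)) + (powScale 1 β)))) ^ 2) * (4 : ℝ) ^ (flatDim L / 2 : ℝ) * Real.exp (-((1 / (4 * sliceConst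 L)) ^ 2 * (powScale 1 β * btLog β ^ 3) ^ 2 / (4 * (powScale 1 β) ^ 2))) * fpWeightBar L (powScale 1 β)) * Real.exp ((96 * (β / 2) + (β)) * (Real.sqrt ((Fintype.card (Edge 3 L) : ℝ)) * (8 * (9 * (L : ℝ) * (5 * (powScale (1 / 2) β * btLog β ^ 2)) + (powScale 1 β)))) ^ 2))) * Real.exp (882 * β * (9 * (L : ℝ) * (5 * (powScale (1 / 2) β * btLog β ^ 2)) + (powScale 1 β)) ^ 2 * ((min (1 / 40) (powScale (1 / 2) β * btLog β)) / 12) ^ 2) +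
              (1:ℝ) * (1:ℝ) * 1 * (Real.exp (2 * β) ^ Fintype.card (Edge 3 L) * Real.exp (-(β * (8 * (9 * (L : ℝ) * (5 * (powScale (1 / 2) β * btLog β ^ 2)) + (powScale 1 β))) ^ 2 / 4))) * Real.exp (49 * β * ((min (1 / 40) (powScale (1 / 2) β * btLog β)) / 12) ^ 2) / stiffGaussTop L (β / 2) β))) / (Real.exp (2 * β) ^ Fintype.card (Edge 3 L) * ((2 * π ^ 2)⁻¹) ^ Fintype.card (Edge 3 L) * fpZ (powScale 1 β) * fpWeightBar L (powScale 1 β)) - 1) * powScale (-(1 / 5)) β) atTop (𝓝 0) ∧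
      Tendsto (fun β : ℝ => (Real.exp (coreEta L β 0 (powScale (1 / 3) β) (9 * (L : ℝ) * (5 * (powScale (1 / 2) β * btLog β ^ 2)) + (powScale 1 β)) (min (1 / 40) (powScale (1 / 2) β * btLog β)) ((powScale 1 β) * Fintype.card (Site 3 L)) (powScale (1 / 2) β) + coreEps1 L β 0 (9 * (L : ℝ) * (5 * (powScale (1 / 2) β * btLog β ^ 2)) + (powScale 1 β)) (min (1 / 40) (powScale (1 / 2) β * btLog β)) + coreEps2 L β 0 (9 * (L : ℝ) * (5 * (powScale (1 / 2) β * btLog β ^ 2)) + (powScale 1 β)) (min (1 / 40) (powScale (1 / 2) β * btLog β)) (powScale (1 / 2) β)) *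
          (1 * (Real.exp (2 * β) ^ Fintype.card (Edge 3 L) * ((2 * π ^ 2)⁻¹) ^ Fintype.card (Edge 3 L) * Real.exp (2000 * Fintype.card (Plaquette 3 L) * (8 * (9 * (L : ℝ) * (5 * (powScale (1 / 2) β * btLog β ^ 2)) + (powScale 1 β))) ^ 3 * β) *
                Real.exp (8 * Fintype.card (Edge 3 L) * β * (8 * (9 * (L : ℝ) * (5 * (powScale (1 / 2) β * btLog β ^ 2)) + (powScale 1 β))) ^ 4) * (fpZ (powScale 1 β) * (1:ℝ) * (Real.exp (((96 * (β / 2) + (β)) * (B * (powScale 1 β * btLog β ^ 3) + MT * (powScale 1 β * btLog β ^ 3) ^ 2) * (2 * (Real.sqrt ((Fintype.card (Edge 3 L) : ℝ)) * (8 * (9 * (L : ℝ) * (5 * (powScale (1 / 2) β * btLog β ^ 2)) + (powScale 1 β))) + (7 * ((Fintype.card (Edge 3 L) : ℝ)) * (8 * (9 * (L : ℝ) * (5 * (powScale (1 / 2) β * btLog β ^ 2)) + (powScale 1 β))) + B * (9 * Ksp * (8 * (9 * (L : ℝ) * (5 * (powScale (1 / 2) β * btLog β ^ 2)) + (powScale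 1 β)))) + MT * (9 * Ksp * (8 * (9 * (L : ℝ) * (5 * (powScale (1 / 2) β * btLog β ^ 2)) + (powScale 1 β)))) ^ 2)) + (B * (powScale 1 β * btLog β ^ 3) + MT * (powScale 1 β * btLog β ^ 3) ^ 2))) + ((96 * (β / 2) + (β)) * ((CL * ((4 + 48 * Ksp) * (8 * (9 * (L : ℝ) * (5 * (powScale (1 / 2) β * btLog β ^ 2)) + (powScale 1 β)))) * (9 * Ksp * (8 * (9 * (L : ℝ) * (5 * (powScale (1 / 2) β * btLog β ^ 2)) + (powScale 1 β)))) + MT * (9 * Ksp * (8 * (9 * (L : ℝ) * (5 * (powScale (1 / 2) β * btLog β ^ 2)) + (powScale 1 β)))) ^ 2) * (2 * (Real.sqrt ((Fintype.card (Edge 3 L) : ℝ)) * (8 * (9 * (L : ℝ) * (5 * (powScale (1 / 2) β * btLog β ^ 2)) + (powScale 1 β))) + (7 * ((Fintype.card (Edge 3 L) : ℝ)) * (8 * (9 * (L : ℝ) * (5 * (powScale (1 / 2) β * btLog β ^ 2)) + (powScale 1 β))) + B * (9 * Ksp * (8 * (9 * (L : ℝ) * (5 * (powScale (1 / 2) β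 * btLog β ^ 2)) + (powScale 1 β)))) + MT * (9 * Ksp * (8 * (9 * (L : ℝ) * (5 * (powScale (1 / 2) β * btLog β ^ 2)) + (powScale 1 β)))) ^ 2)) + (CL * ((4 + 48 * Ksp) * (8 * (9 * (L : ℝ) * (5 * (powScale (1 / 2) β * btLog β ^ 2)) + (powScale 1 β)))) * (9 * Ksp * (8 * (9 * (L : ℝ) * (5 * (powScale (1 / 2) β * btLog β ^ 2)) + (powScale 1 β)))) + MT * (9 * Ksp * (8 * (9 * (L : ℝ) * (5 * (powScale (1 / 2) β * btLog β ^ 2)) + (powScale 1 β)))) ^ 2)) + 72 * ((Fintype.card (Edge 3 L) : ℝ)) * (8 * (9 * (L : ℝ) * (5 * (powScale (1 / 2) β * btLog β ^ 2)) + (powScale 1 β))) ^ 3))) * (fpWeightBar L (powScale 1 β) * (1 + Cp * (1 * powScale (1 / 4) β) ^ 2)) + ((1 + KD * ((4 + 48 * Ksp) * (8 * (9 * (L : ℝ) * (5 * (powScale (1 / 2) β * btLog β ^ 2)) + (powScale 1 β)))) ^ 2) * (4 : ℝ) ^ (flatDim L / 2 : ℝ) * Real.exp (-((1 / (4 * sliceConst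 L)) ^ 2 * (powScale 1 β * btLog β ^ 3) ^ 2 / (4 * (powScale 1 β) ^ 2))) * fpWeightBar L (powScale 1 β)) * Real.exp ((96 * (β / 2) + (β)) * (Real.sqrt ((Fintype.card (Edge 3 L) : ℝ)) * (8 * (9 * (L : ℝ) * (5 * (powScale (1 / 2) β * btLog β ^ 2)) + (powScale 1 β)))) ^ 2))) * Real.exp (882 * β * (9 * (L : ℝ) * (5 * (powScale (1 / 2) β * btLog β ^ 2)) + (powScale 1 β)) ^ 2 * ((min (1 / 40) (powScale (1 / 2) β * btLog β)) / 12) ^ 2) +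
              (1:ℝ) * (1:ℝ) * 1 * (Real.exp (2 * β) ^ Fintype.card (Edge 3 L) * Real.exp (-(β * (8 * (9 * (L : ℝ) * (5 * (powScale (1 / 2) β * btLog β ^ 2)) + (powScale 1 β))) ^ 2 / 4))) * Real.exp (49 * β * ((min (1 / 40) (powScale (1 / 2) β * btLog β)) / 12) ^ 2) / stiffGaussTop L (β / 2) β))) / (Real.exp (2 * β) ^ Fintype.card (Edge 3 L) * ((2 * π ^ 2)⁻¹) ^ Fintype.card (Edge 3 L) * fpZ (powScale 1 β) * fpWeightBar L (powScale 1 β))) atTop (𝓝 1) := by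
  have hNpos : ∀ β : ℝ, 0 < (Real.exp (2 * β) ^ Fintype.card (Edge 3 L) * ((2 * π ^ 2)⁻¹) ^ Fintype.card (Edge 3 L) * fpZ (powScale 1 β) * fpWeightBar L (powScale 1 β)) := fun β => by
    have := fpZ_pos (powScale_pos 1 β); have := fpWeightBar_pos (L := L) (powScale_pos 1 β); positivity
  have pX := zt_smearing (L := L)
  have eXp := wt_exp pX.1 pX.2
  have hG : Tendsto (fun β : ℝ => 2000 * Fintype.card (Plaquette 3 L) * (8 * (9 * (L : ℝ) * (5 * (powScale (1 / 2) β * btLog β ^ 2)) + powScale 1 β)) ^ 3 * β * powScale (-(1 / 5)) β) atTop (𝓝 0) ∧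
      Tendsto (fun β : ℝ => 2000 * Fintype.card (Plaquette 3 L) * (8 * (9 * (L : ℝ) * (5 * (powScale (1 / 2) β * btLog β ^ 2)) + powScale 1 β)) ^ 3 * β) atTop (𝓝 0) := by
    have h := zt_const_mul (2000 * (Fintype.card (Plaquette 3 L) : ℝ)) (zt_beta_rho_cube (L := L))
    exact ⟨h.1.congr' (Eventually.of_forall fun β => by ring), h.2.congr' (Eventually.of_forall fun β => by ring)⟩
  have tGp := wt_exp hG.1 hG.2
  have hG4 : Tendsto (fun β : ℝ => 8 * Fintype.card (Edge 3 L) * β * (8 * (9 * (L : ℝ) * (5 * (powScale (1 / 2) β * btLog β ^ 2)) + powScale 1 β)) ^ 4 * powScale (-(1 / 5)) β) atTop (𝓝 0) ∧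
      Tendsto (fun β : ℝ => 8 * Fintype.card (Edge 3 L) * β * (8 * (9 * (L : ℝ) * (5 * (powScale (1 / 2) β * btLog β ^ 2)) + powScale 1 β)) ^ 4) atTop (𝓝 0) := by
    have h := zt_const_mul (8 * (Fintype.card (Edge 3 L) : ℝ)) (zt_beta_rho_four (L := L))
    exact ⟨h.1.congr' (Eventually.of_forall fun β => by ring), h.2.congr' (Eventually.of_forall fun β => by ring)⟩
  have tG4 := wt_exp hG4.1 hG4.2
  have eDp := wt_exp (zt_transport_defects (L := L) Ksp MT B CL).2 (tendsto_transport_defects (L := L) Ksp MT B CL).2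
  have tdp := wt_one_add (zt_defect Cp)
  have tTbG := zt_sliceTail_mul_gaussLoss (L := L) KD Ksp
  have hloc := zt_loc (L := L)
  have tE1p := wt_exp hloc.1 hloc.2
  have tFar := zt_farTail (L := L)
  have pghi := wt_add_tail (wt_mul (wt_mul (wt_mul (wt_mul eXp tGp) tG4) (wt_add_tail (wt_mul eDp tdp) tTbG)) tE1p) (zt_mul eXp tFar)
  refine wt_congr pghi ?_
  filter_upwards [eventually_ge_atTop (1 : ℝ)] with β hβ
  have hZ := fpZ_pos (powScale_pos 1 β)
  have hW := fpWeightBar_pos (L := L) (powScale_pos 1 β)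
  obtain ⟨hSlo, -⟩ := stiffGaussTop_record_bounds (L := L) (show (0 : ℝ) < β by linarith)
  have hS : 0 < stiffGaussTop L (β / 2) β := lt_of_lt_of_le (pow_pos (Real.sqrt_pos.2 (by positivity)) _) hSlo
  have hQ : (0 : ℝ) < ((2 * π ^ 2)⁻¹) ^ Fintype.card (Edge 3 L) := by positivity
  have hfar : Real.exp (-(β * (8 * (9 * (L : ℝ) * (5 * (powScale (1 / 2) β * btLog β ^ 2)) + powScale 1 β)) ^ 2 / 4)) * Real.exp (49 * β * ((min (1 / 40) (powScale (1 / 2) β * btLog β)) / 12) ^ 2) / stiffGaussTop L (β / 2) β / (((2 * π ^ 2)⁻¹) ^ Fintype.card (Edge 3 L) * fpZ (powScale 1 β) * fpWeightBar L (powScale 1 β)) * (Real.exp (2 * β) ^ Fintype.card (Edge 3 L) * ((2 * π ^ 2)⁻¹) ^ Fintype.card (Edge 3 L) * fpZ (powScale 1 β) * fpWeightBar L (powScale 1 β)) =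
        Real.exp (2 * β) ^ Fintype.card (Edge 3 L) * Real.exp (-(β * (8 * (9 * (L : ℝ) * (5 * (powScale (1 / 2) β * btLog β ^ 2)) + powScale 1 β)) ^ 2 / 4)) * Real.exp (49 * β * ((min (1 / 40) (powScale (1 / 2) β * btLog β)) / 12) ^ 2) / stiffGaussTop L (β / 2) β := by
    field_simp
  rw [eq_div_iff (hNpos β).ne', add_mul, mul_assoc (Real.exp (coreEta L β 0 (powScale (1 / 3) β) (9 * (L : ℝ) * (5 * (powScale (1 / 2) β * btLog β ^ 2)) + (powScale 1 β)) (min (1 / 40) (powScale (1 / 2) β * btLog β)) ((powScale 1 β) * Fintype.card (Site 3 L)) (powScale (1 / 2) β) + coreEps1 L β 0 (9 * (L : ℝ) * (5 * (powScale (1 / 2) β * btLog β ^ 2)) + (powScale 1 β)) (min (1 / 40) (powScale (1 / 2) β * btLog β)) + coreEps2 L β 0 (9 * (L : ℝ) * (5 * (powScale (1 / 2) β * btLog β ^ 2)) + (powScale 1 β)) (min (1 / 40) (powScale (1 / 2) β * btLog β)) (powScale (1 / 2) β))) (Real.exp (-(β * (8 * (9 * (L : ℝ) * (5 * (powScale (1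 / 2) β * btLog β ^ 2)) + powScale 1 β)) ^ 2 / 4)) * Real.exp (49 * β * ((min (1 / 40) (powScale (1 / 2) β * btLog β)) / 12) ^ 2) / stiffGaussTop L (β / 2) β / (((2 * π ^ 2)⁻¹) ^ Fintype.card (Edge 3 L) * fpZ (powScale 1 β) * fpWeightBar L (powScale 1 β))) (Real.exp (2 * β) ^ Fintype.card (Edge 3 L) * ((2 * π ^ 2)⁻¹) ^ Fintype.card (Edge 3 L) * fpZ (powScale 1 β) * fpWeightBar L (powScale 1 β)), hfar]
  ring

/-! ## §2 ★★ The rate -/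

set_option maxHeartbeats 800000 in
-- the statement displays the two ~4k-character bounds of record verbatim.
/-- ★★ **THE RATE `hi₀ ≤ (1 + β^{-1/5})·lo₀` for the two-sided central transfer bound of record (repaired smearing window).**
For all real constants: eventually `0 < lo₀(β)` and `hi₀(β) ≤ (1 + powScale (1/5) β)·lo₀(β)`. [folklore] -/
theorem central_ratio_rate (Ksp MT KD B CL Cp : ℝ) :
    ∀ᶠ β : ℝ in atTop,
      0 < Real.exp (-(coreEta L β 0 (powScale (1 / 3) β) (9 * (L : ℝ) * (5 * (powScale (1 / 2) β * btLog β ^ 2)) + (powScale 1 β)) (min (1 / 40) (powScale (1 / 2) β * btLog β)) ((powScale 1 β) * Fintype.card (Site 3 L)) (powScale (1 / 2) β) + coreEps1 L β 0 (9 * (L : ℝ) * (5 * (powScale (1 / 2) β * btLog β ^ 2)) + (powScale 1 β)) (min (1 / 40) (powScale (1 / 2) β * btLog β)) + coreEps2 L β 0 (9 * (L : ℝ) * (5 * (powScale (1 / 2) β * btLog β ^ 2)) + (powScale 1 β)) (min (1 / 40) (powScale (1 / 2) β * btLog β)) (powScale (1 / 2) β))) *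
          (1 * (Real.exp (2 * β) ^ Fintype.card (Edge 3 L) * ((2 * π ^ 2)⁻¹ * ((1 + (8 * (9 * (L : ℝ) * (5 * (powScale (1 / 2) β * btLog β ^ 2)) + (powScale 1 β))) ^ 2)⁻¹) ^ 2) ^ Fintype.card (Edge 3 L) *
              Real.exp (-(2000 * Fintype.card (Plaquette 3 L) * (8 * (9 * (L : ℝ) * (5 * (powScale (1 / 2) β * btLog β ^ 2)) + (powScale 1 β))) ^ 3 * β)) * (fpZ (powScale 1 β) * ((1:ℝ) * Real.exp (-(((96 * (β / 2) + (β)) * (B * (powScale 1 β * btLog β ^ 3) + MT * (powScale 1 β * btLog β ^ 3) ^ 2) * (2 * ((((min (1 / 40) (powScale (1 / 2) β * btLog β)) / 12) + (9 / 10 * (min (1 / 40) (powScale (1 / 2) β * btLog β)))) + 14 * ((Fintype.card (Edge 3 L) : ℝ)) * (8 * (9 * (L : ℝ) * (5 * (powScale (1 / 2) β * btLog β ^ 2)) + (powScale 1 β))) ^ 2 + (CL * ((4 + 48 * Ksp) * (8 * (9 * (L : ℝ) * (5 * (powScale (1 / 2) β * btLog β ^ 2)) + (powScale 1 β)))) *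 (9 * Ksp * (8 * (9 * (L : ℝ) * (5 * (powScale (1 / 2) β * btLog β ^ 2)) + (powScale 1 β)))) + MT * (9 * Ksp * (8 * (9 * (L : ℝ) * (5 * (powScale (1 / 2) β * btLog β ^ 2)) + (powScale 1 β)))) ^ 2)) + (B * (powScale 1 β * btLog β ^ 3) + MT * (powScale 1 β * btLog β ^ 3) ^ 2))) + ((96 * (β / 2) + (β)) * ((CL * ((4 + 48 * Ksp) * (8 * (9 * (L : ℝ) * (5 * (powScale (1 / 2) β * btLog β ^ 2)) + (powScale 1 β)))) * (9 * Ksp * (8 * (9 * (L : ℝ) * (5 * (powScale (1 / 2) β * btLog β ^ 2)) + (powScale 1 β)))) + MT * (9 * Ksp * (8 * (9 * (L : ℝ) * (5 * (powScale (1 / 2) β * btLog β ^ 2)) + (powScale 1 β)))) ^ 2) * (2 * ((((min (1 / 40) (powScale (1 / 2) β * btLog β)) / 12) + (9 / 10 * (min (1 / 40) (powScale (1 / 2) β * btLog β)))) + 14 * ((Fintype.card (Edge 3 L) : ℝ)) * (8 * (9 * (L : ℝ) * (5 * (powScale (1 / 2) β * btLog β ^ 2)) + (powScale 1 β))) ^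 2 + (CL * ((4 + 48 * Ksp) * (8 * (9 * (L : ℝ) * (5 * (powScale (1 / 2) β * btLog β ^ 2)) + (powScale 1 β)))) * (9 * Ksp * (8 * (9 * (L : ℝ) * (5 * (powScale (1 / 2) β * btLog β ^ 2)) + (powScale 1 β)))) + MT * (9 * Ksp * (8 * (9 * (L : ℝ) * (5 * (powScale (1 / 2) β * btLog β ^ 2)) + (powScale 1 β)))) ^ 2)) + (CL * ((4 + 48 * Ksp) * (8 * (9 * (L : ℝ) * (5 * (powScale (1 / 2) β * btLog β ^ 2)) + (powScale 1 β)))) * (9 * Ksp * (8 * (9 * (L : ℝ) * (5 * (powScale (1 / 2) β * btLog β ^ 2)) + (powScale 1 β)))) + MT * (9 * Ksp * (8 * (9 * (L : ℝ) * (5 * (powScale (1 / 2) β * btLog β ^ 2)) + (powScale 1 β)))) ^ 2)) + 72 * ((Fintype.card (Edge 3 L) : ℝ)) * (8 * (9 * (L : ℝ) * (5 * (powScale (1 / 2) β * btLog β ^ 2)) + (powScale 1 β))) ^ 3)))) * ((fpWeightBar L (powScale 1 β) * (1 - Cp * (1 * powScale (1 / 4) β) ^ 2)) - ((1 + KD *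 ((4 + 48 * Ksp) * (8 * (9 * (L : ℝ) * (5 * (powScale (1 / 2) β * btLog β ^ 2)) + (powScale 1 β)))) ^ 2) * (4 : ℝ) ^ (flatDim L / 2 : ℝ) * Real.exp (-((1 / (4 * sliceConst L)) ^ 2 * (powScale 1 β * btLog β ^ 3) ^ 2 / (4 * (powScale 1 β) ^ 2))) * fpWeightBar L (powScale 1 β))))) *
            (Real.exp (-(882 * β * (9 * (L : ℝ) * (5 * (powScale (1 / 2) β * btLog β ^ 2)) + (powScale 1 β)) ^ 2 * ((min (1 / 40) (powScale (1 / 2) β * btLog β)) / 12) ^ 2)) -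
              Real.exp (49 * β * ((min (1 / 40) (powScale (1 / 2) β * btLog β)) / 12) ^ 2) * (Real.exp (-(β * (min ((8 * (9 * (L : ℝ) * (5 * (powScale (1 / 2) β * btLog β ^ 2)) + (powScale 1 β))) - 2 * (9 * (L : ℝ) * (5 * (powScale (1 / 2) β * btLog β ^ 2)) + (powScale 1 β))) ((9 / 10 * (min (1 / 40) (powScale (1 / 2) β * btLog β))) - 6 * (9 * (L : ℝ) * (5 * (powScale (1 / 2) β * btLog β ^ 2)) + (powScale 1 β)) ^ 2 * ((min (1 / 40) (powScale (1 / 2) β * btLog β)) / 12))) ^ 2 / 2)) * (π / (β / 2)) ^ ((Module.finrank ℝ (LinkSpace L) : ℝ) / 2)) /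
                stiffGaussTop L (β / 2) β))) ∧
      Real.exp (coreEta L β 0 (powScale (1 / 3) β) (9 * (L : ℝ) * (5 * (powScale (1 / 2) β * btLog β ^ 2)) + (powScale 1 β)) (min (1 / 40) (powScale (1 / 2) β * btLog β)) ((powScale 1 β) * Fintype.card (Site 3 L)) (powScale (1 / 2) β) + coreEps1 L β 0 (9 * (L : ℝ) * (5 * (powScale (1 / 2) β * btLog β ^ 2)) + (powScale 1 β)) (min (1 / 40) (powScale (1 / 2) β * btLog β)) + coreEps2 L β 0 (9 * (L : ℝ) * (5 * (powScale (1 / 2) β * btLog β ^ 2)) + (powScale 1 β)) (min (1 / 40) (powScale (1 / 2) β * btLog β)) (powScale (1 / 2) β)) *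
          (1 * (Real.exp (2 * β) ^ Fintype.card (Edge 3 L) * ((2 * π ^ 2)⁻¹) ^ Fintype.card (Edge 3 L) * Real.exp (2000 * Fintype.card (Plaquette 3 L) * (8 * (9 * (L : ℝ) * (5 * (powScale (1 / 2) β * btLog β ^ 2)) + (powScale 1 β))) ^ 3 * β) *
                Real.exp (8 * Fintype.card (Edge 3 L) * β * (8 * (9 * (L : ℝ) * (5 * (powScale (1 / 2) β * btLog β ^ 2)) + (powScale 1 β))) ^ 4) * (fpZ (powScale 1 β) * (1:ℝ) * (Real.exp (((96 * (β / 2) + (β)) * (B * (powScale 1 β * btLog β ^ 3) + MT * (powScale 1 β * btLog β ^ 3) ^ 2) * (2 * (Real.sqrt ((Fintype.card (Edge 3 L) : ℝ)) * (8 * (9 * (L : ℝ) * (5 * (powScale (1 / 2) β * btLog β ^ 2)) + (powScale 1 β))) + (7 * ((Fintype.card (Edge 3 L) : ℝ)) * (8 * (9 * (L : ℝ) * (5 * (powScale (1 / 2) β * btLog β ^ 2)) + (powScale 1 β))) + B * (9 * Ksp * (8 * (9 * (L : ℝ) * (5 * (powScale (1 / 2) β * btLog β ^ 2)) + (powScale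 1 β)))) + MT * (9 * Ksp * (8 * (9 * (L : ℝ) * (5 * (powScale (1 / 2) β * btLog β ^ 2)) + (powScale 1 β)))) ^ 2)) + (B * (powScale 1 β * btLog β ^ 3) + MT * (powScale 1 β * btLog β ^ 3) ^ 2))) + ((96 * (β / 2) + (β)) * ((CL * ((4 + 48 * Ksp) * (8 * (9 * (L : ℝ) * (5 * (powScale (1 / 2) β * btLog β ^ 2)) + (powScale 1 β)))) * (9 * Ksp * (8 * (9 * (L : ℝ) * (5 * (powScale (1 / 2) β * btLog β ^ 2)) + (powScale 1 β)))) + MT * (9 * Ksp * (8 * (9 * (L : ℝ) * (5 * (powScale (1 / 2) β * btLog β ^ 2)) + (powScale 1 β)))) ^ 2) * (2 * (Real.sqrt ((Fintype.card (Edge 3 L) : ℝ)) * (8 * (9 * (L : ℝ) * (5 * (powScale (1 / 2) β * btLog β ^ 2)) + (powScale 1 β))) + (7 * ((Fintype.card (Edge 3 L) : ℝ)) * (8 * (9 * (L : ℝ) * (5 * (powScale (1 / 2) β * btLog β ^ 2)) + (powScale 1 β))) + B * (9 * Ksp * (8 * (9 * (L : ℝ) * (5 * (powScale (1 / 2) β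 * btLog β ^ 2)) + (powScale 1 β)))) + MT * (9 * Ksp * (8 * (9 * (L : ℝ) * (5 * (powScale (1 / 2) β * btLog β ^ 2)) + (powScale 1 β)))) ^ 2)) + (CL * ((4 + 48 * Ksp) * (8 * (9 * (L : ℝ) * (5 * (powScale (1 / 2) β * btLog β ^ 2)) + (powScale 1 β)))) * (9 * Ksp * (8 * (9 * (L : ℝ) * (5 * (powScale (1 / 2) β * btLog β ^ 2)) + (powScale 1 β)))) + MT * (9 * Ksp * (8 * (9 * (L : ℝ) * (5 * (powScale (1 / 2) β * btLog β ^ 2)) + (powScale 1 β)))) ^ 2)) + 72 * ((Fintype.card (Edge 3 L) : ℝ)) * (8 * (9 * (L : ℝ) * (5 * (powScale (1 / 2) β * btLog β ^ 2)) + (powScale 1 β))) ^ 3))) * (fpWeightBar L (powScale 1 β) * (1 + Cp * (1 * powScale (1 / 4) β) ^ 2)) + ((1 + KD * ((4 + 48 * Ksp) * (8 * (9 * (L : ℝ) * (5 * (powScale (1 / 2) β * btLog β ^ 2)) + (powScale 1 β)))) ^ 2) * (4 : ℝ) ^ (flatDim L / 2 : ℝ) * Real.exp (-((1 / (4 * sliceConst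 L)) ^ 2 * (powScale 1 β * btLog β ^ 3) ^ 2 / (4 * (powScale 1 β) ^ 2))) * fpWeightBar L (powScale 1 β)) * Real.exp ((96 * (β / 2) + (β)) * (Real.sqrt ((Fintype.card (Edge 3 L) : ℝ)) * (8 * (9 * (L : ℝ) * (5 * (powScale (1 / 2) β * btLog β ^ 2)) + (powScale 1 β)))) ^ 2))) * Real.exp (882 * β * (9 * (L : ℝ) * (5 * (powScale (1 / 2) β * btLog β ^ 2)) + (powScale 1 β)) ^ 2 * ((min (1 / 40) (powScale (1 / 2) β * btLog β)) / 12) ^ 2) +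
              (1:ℝ) * (1:ℝ) * 1 * (Real.exp (2 * β) ^ Fintype.card (Edge 3 L) * Real.exp (-(β * (8 * (9 * (L : ℝ) * (5 * (powScale (1 / 2) β * btLog β ^ 2)) + (powScale 1 β))) ^ 2 / 4))) * Real.exp (49 * β * ((min (1 / 40) (powScale (1 / 2) β * btLog β)) / 12) ^ 2) / stiffGaussTop L (β / 2) β)) ≤ (1 + powScale (1 / 5) β) * (Real.exp (-(coreEta L β 0 (powScale (1 / 3) β) (9 * (L : ℝ) * (5 * (powScale (1 / 2) β * btLog β ^ 2)) + (powScale 1 β)) (min (1 / 40) (powScale (1 / 2) β * btLog β)) ((powScale 1 β) * Fintype.card (Site 3 L)) (powScale (1 / 2) β) + coreEps1 L β 0 (9 * (L : ℝ) * (5 * (powScale (1 / 2) β * btLog β ^ 2)) + (powScale 1 β)) (min (1 / 40) (powScale (1 / 2) β * btLog β)) + coreEps2 L β 0 (9 * (L : ℝ) * (5 * (powScale (1 / 2) β * btLog β ^ 2)) + (powScale 1 β)) (min (1 / 40) (powScale (1 / 2) β * btLog β)) (powScale (1 / 2) β))) *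
          (1 * (Real.exp (2 * β) ^ Fintype.card (Edge 3 L) * ((2 * π ^ 2)⁻¹ * ((1 + (8 * (9 * (L : ℝ) * (5 * (powScale (1 / 2) β * btLog β ^ 2)) + (powScale 1 β))) ^ 2)⁻¹) ^ 2) ^ Fintype.card (Edge 3 L) *
              Real.exp (-(2000 * Fintype.card (Plaquette 3 L) * (8 * (9 * (L : ℝ) * (5 * (powScale (1 / 2) β * btLog β ^ 2)) + (powScale 1 β))) ^ 3 * β)) * (fpZ (powScale 1 β) * ((1:ℝ) * Real.exp (-(((96 * (β / 2) + (β)) * (B * (powScale 1 β * btLog β ^ 3) + MT * (powScale 1 β * btLog β ^ 3) ^ 2) * (2 * ((((min (1 / 40) (powScale (1 / 2) β * btLog β)) / 12) + (9 / 10 * (min (1 / 40) (powScale (1 / 2) β * btLog β)))) + 14 * ((Fintype.card (Edge 3 L) : ℝ)) * (8 * (9 * (L : ℝ) * (5 * (powScale (1 / 2) β * btLog β ^ 2)) + (powScale 1 β))) ^ 2 + (CL * ((4 + 48 * Ksp) * (8 * (9 * (L : ℝ) * (5 * (powScale (1 / 2) β * btLog β ^ 2)) + (powScale 1 β)))) *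 (9 * Ksp * (8 * (9 * (L : ℝ) * (5 * (powScale (1 / 2) β * btLog β ^ 2)) + (powScale 1 β)))) + MT * (9 * Ksp * (8 * (9 * (L : ℝ) * (5 * (powScale (1 / 2) β * btLog β ^ 2)) + (powScale 1 β)))) ^ 2)) + (B * (powScale 1 β * btLog β ^ 3) + MT * (powScale 1 β * btLog β ^ 3) ^ 2))) + ((96 * (β / 2) + (β)) * ((CL * ((4 + 48 * Ksp) * (8 * (9 * (L : ℝ) * (5 * (powScale (1 / 2) β * btLog β ^ 2)) + (powScale 1 β)))) * (9 * Ksp * (8 * (9 * (L : ℝ) * (5 * (powScale (1 / 2) β * btLog β ^ 2)) + (powScale 1 β)))) + MT * (9 * Ksp * (8 * (9 * (L : ℝ) * (5 * (powScale (1 / 2) β * btLog β ^ 2)) + (powScale 1 β)))) ^ 2) * (2 * ((((min (1 / 40) (powScale (1 / 2) β * btLog β)) / 12) + (9 / 10 * (min (1 / 40) (powScale (1 / 2) β * btLog β)))) + 14 * ((Fintype.card (Edge 3 L) : ℝ)) * (8 * (9 * (L : ℝ) * (5 * (powScale (1 / 2) β * btLog β ^ 2)) + (powScale 1 β))) ^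 2 + (CL * ((4 + 48 * Ksp) * (8 * (9 * (L : ℝ) * (5 * (powScale (1 / 2) β * btLog β ^ 2)) + (powScale 1 β)))) * (9 * Ksp * (8 * (9 * (L : ℝ) * (5 * (powScale (1 / 2) β * btLog β ^ 2)) + (powScale 1 β)))) + MT * (9 * Ksp * (8 * (9 * (L : ℝ) * (5 * (powScale (1 / 2) β * btLog β ^ 2)) + (powScale 1 β)))) ^ 2)) + (CL * ((4 + 48 * Ksp) * (8 * (9 * (L : ℝ) * (5 * (powScale (1 / 2) β * btLog β ^ 2)) + (powScale 1 β)))) * (9 * Ksp * (8 * (9 * (L : ℝ) * (5 * (powScale (1 / 2) β * btLog β ^ 2)) + (powScale 1 β)))) + MT * (9 * Ksp * (8 * (9 * (L : ℝ) * (5 * (powScale (1 / 2) β * btLog β ^ 2)) + (powScale 1 β)))) ^ 2)) + 72 * ((Fintype.card (Edge 3 L) : ℝ)) * (8 * (9 * (L : ℝ) * (5 * (powScale (1 / 2) β * btLog β ^ 2)) + (powScale 1 β))) ^ 3)))) * ((fpWeightBar L (powScale 1 β) * (1 - Cp * (1 * powScale (1 / 4) β) ^ 2)) - ((1 + KD *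 ((4 + 48 * Ksp) * (8 * (9 * (L : ℝ) * (5 * (powScale (1 / 2) β * btLog β ^ 2)) + (powScale 1 β)))) ^ 2) * (4 : ℝ) ^ (flatDim L / 2 : ℝ) * Real.exp (-((1 / (4 * sliceConst L)) ^ 2 * (powScale 1 β * btLog β ^ 3) ^ 2 / (4 * (powScale 1 β) ^ 2))) * fpWeightBar L (powScale 1 β))))) *
            (Real.exp (-(882 * β * (9 * (L : ℝ) * (5 * (powScale (1 / 2) β * btLog β ^ 2)) + (powScale 1 β)) ^ 2 * ((min (1 / 40) (powScale (1 / 2) β * btLog β)) / 12) ^ 2)) -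
              Real.exp (49 * β * ((min (1 / 40) (powScale (1 / 2) β * btLog β)) / 12) ^ 2) * (Real.exp (-(β * (min ((8 * (9 * (L : ℝ) * (5 * (powScale (1 / 2) β * btLog β ^ 2)) + (powScale 1 β))) - 2 * (9 * (L : ℝ) * (5 * (powScale (1 / 2) β * btLog β ^ 2)) + (powScale 1 β))) ((9 / 10 * (min (1 / 40) (powScale (1 / 2) β * btLog β))) - 6 * (9 * (L : ℝ) * (5 * (powScale (1 / 2) β * btLog β ^ 2)) + (powScale 1 β)) ^ 2 * ((min (1 / 40) (powScale (1 / 2) β * btLog β)) / 12))) ^ 2 / 2)) * (π / (β / 2)) ^ ((Module.finrank ℝ (LinkSpace L) : ℝ) / 2)) /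
                stiffGaussTop L (β / 2) β)))) := by
  have hNpos : ∀ β : ℝ, 0 < (Real.exp (2 * β) ^ Fintype.card (Edge 3 L) * ((2 * π ^ 2)⁻¹) ^ Fintype.card (Edge 3 L) * fpZ (powScale 1 β) * fpWeightBar L (powScale 1 β)) := fun β => by
    have := fpZ_pos (powScale_pos 1 β); have := fpWeightBar_pos (L := L) (powScale_pos 1 β); positivity
  obtain ⟨wlo, tlo⟩ := weighted_lo (L := L) Ksp MT KD B CL Cp
  obtain ⟨whi, -⟩ := weighted_hi (L := L) Ksp MT KD B CL Cp
  have hd := tendsto_sub_mul_weight wlo whi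
  have hev1 : ∀ᶠ β : ℝ in atTop, (1 : ℝ) / 2 < (Real.exp (-(coreEta L β 0 (powScale (1 / 3) β) (9 * (L : ℝ) * (5 * (powScale (1 / 2) β * btLog β ^ 2)) + (powScale 1 β)) (min (1 / 40) (powScale (1 / 2) β * btLog β)) ((powScale 1 β) * Fintype.card (Site 3 L)) (powScale (1 / 2) β) + coreEps1 L β 0 (9 * (L : ℝ) * (5 * (powScale (1 / 2) β * btLog β ^ 2)) + (powScale 1 β)) (min (1 / 40) (powScale (1 / 2) β * btLog β)) + coreEps2 L β 0 (9 * (L : ℝ) * (5 * (powScale (1 / 2) β * btLog β ^ 2)) + (powScale 1 β)) (min (1 / 40) (powScale (1 / 2) β * btLog β)) (powScale (1 / 2) β))) *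
          (1 * (Real.exp (2 * β) ^ Fintype.card (Edge 3 L) * ((2 * π ^ 2)⁻¹ * ((1 + (8 * (9 * (L : ℝ) * (5 * (powScale (1 / 2) β * btLog β ^ 2)) + (powScale 1 β))) ^ 2)⁻¹) ^ 2) ^ Fintype.card (Edge 3 L) *
              Real.exp (-(2000 * Fintype.card (Plaquette 3 L) * (8 * (9 * (L : ℝ) * (5 * (powScale (1 / 2) β * btLog β ^ 2)) + (powScale 1 β))) ^ 3 * β)) * (fpZ (powScale 1 β) * ((1:ℝ) * Real.exp (-(((96 * (β / 2) + (β)) * (B * (powScale 1 β * btLog β ^ 3) + MT * (powScale 1 β * btLog β ^ 3) ^ 2) * (2 * ((((min (1 / 40) (powScale (1 / 2) β * btLog β)) / 12) + (9 / 10 * (min (1 / 40) (powScale (1 / 2) β * btLog β)))) + 14 * ((Fintype.card (Edge 3 L) : ℝ)) * (8 * (9 * (L : ℝ) * (5 * (powScale (1 / 2) β * btLog β ^ 2)) + (powScale 1 β))) ^ 2 + (CL * ((4 + 48 * Ksp) * (8 * (9 * (L : ℝ) * (5 * (powScale (1 / 2) β * btLog β ^ 2)) + (powScale 1 β)))) *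 (9 * Ksp * (8 * (9 * (L : ℝ) * (5 * (powScale (1 / 2) β * btLog β ^ 2)) + (powScale 1 β)))) + MT * (9 * Ksp * (8 * (9 * (L : ℝ) * (5 * (powScale (1 / 2) β * btLog β ^ 2)) + (powScale 1 β)))) ^ 2)) + (B * (powScale 1 β * btLog β ^ 3) + MT * (powScale 1 β * btLog β ^ 3) ^ 2))) + ((96 * (β / 2) + (β)) * ((CL * ((4 + 48 * Ksp) * (8 * (9 * (L : ℝ) * (5 * (powScale (1 / 2) β * btLog β ^ 2)) + (powScale 1 β)))) * (9 * Ksp * (8 * (9 * (L : ℝ) * (5 * (powScale (1 / 2) β * btLog β ^ 2)) + (powScale 1 β)))) + MT * (9 * Ksp * (8 * (9 * (L : ℝ) * (5 * (powScale (1 / 2) β * btLog β ^ 2)) + (powScale 1 β)))) ^ 2) * (2 * ((((min (1 / 40) (powScale (1 / 2) β * btLog β)) / 12) + (9 / 10 * (min (1 / 40) (powScale (1 / 2) β * btLog β)))) + 14 * ((Fintype.card (Edge 3 L) : ℝ)) * (8 * (9 * (L : ℝ) * (5 * (powScale (1 / 2) β * btLog β ^ 2)) + (powScale 1 β))) ^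 2 + (CL * ((4 + 48 * Ksp) * (8 * (9 * (L : ℝ) * (5 * (powScale (1 / 2) β * btLog β ^ 2)) + (powScale 1 β)))) * (9 * Ksp * (8 * (9 * (L : ℝ) * (5 * (powScale (1 / 2) β * btLog β ^ 2)) + (powScale 1 β)))) + MT * (9 * Ksp * (8 * (9 * (L : ℝ) * (5 * (powScale (1 / 2) β * btLog β ^ 2)) + (powScale 1 β)))) ^ 2)) + (CL * ((4 + 48 * Ksp) * (8 * (9 * (L : ℝ) * (5 * (powScale (1 / 2) β * btLog β ^ 2)) + (powScale 1 β)))) * (9 * Ksp * (8 * (9 * (L : ℝ) * (5 * (powScale (1 / 2) β * btLog β ^ 2)) + (powScale 1 β)))) + MT * (9 * Ksp * (8 * (9 * (L : ℝ) * (5 * (powScale (1 / 2) β * btLog β ^ 2)) + (powScale 1 β)))) ^ 2)) + 72 * ((Fintype.card (Edge 3 L) : ℝ)) * (8 * (9 * (L : ℝ) * (5 * (powScale (1 / 2) β * btLog β ^ 2)) + (powScale 1 β))) ^ 3)))) * ((fpWeightBar L (powScale 1 β) * (1 - Cp * (1 * powScale (1 / 4) β) ^ 2)) - ((1 + KD *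 ((4 + 48 * Ksp) * (8 * (9 * (L : ℝ) * (5 * (powScale (1 / 2) β * btLog β ^ 2)) + (powScale 1 β)))) ^ 2) * (4 : ℝ) ^ (flatDim L / 2 : ℝ) * Real.exp (-((1 / (4 * sliceConst L)) ^ 2 * (powScale 1 β * btLog β ^ 3) ^ 2 / (4 * (powScale 1 β) ^ 2))) * fpWeightBar L (powScale 1 β))))) *
            (Real.exp (-(882 * β * (9 * (L : ℝ) * (5 * (powScale (1 / 2) β * btLog β ^ 2)) + (powScale 1 β)) ^ 2 * ((min (1 / 40) (powScale (1 / 2) β * btLog β)) / 12) ^ 2)) -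
              Real.exp (49 * β * ((min (1 / 40) (powScale (1 / 2) β * btLog β)) / 12) ^ 2) * (Real.exp (-(β * (min ((8 * (9 * (L : ℝ) * (5 * (powScale (1 / 2) β * btLog β ^ 2)) + (powScale 1 β))) - 2 * (9 * (L : ℝ) * (5 * (powScale (1 / 2) β * btLog β ^ 2)) + (powScale 1 β))) ((9 / 10 * (min (1 / 40) (powScale (1 / 2) β * btLog β))) - 6 * (9 * (L : ℝ) * (5 * (powScale (1 / 2) β * btLog β ^ 2)) + (powScale 1 β)) ^ 2 * ((min (1 / 40) (powScale (1 / 2) β * btLog β)) / 12))) ^ 2 / 2)) * (π / (β / 2)) ^ ((Module.finrank ℝ (LinkSpace L) : ℝ) / 2)) /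
                stiffGaussTop L (β / 2) β)))) / (Real.exp (2 * β) ^ Fintype.card (Edge 3 L) * ((2 * π ^ 2)⁻¹) ^ Fintype.card (Edge 3 L) * fpZ (powScale 1 β) * fpWeightBar L (powScale 1 β)) := tlo.eventually (Ioi_mem_nhds (by norm_num))
  have hev2 : ∀ᶠ β : ℝ in atTop, ((Real.exp (coreEta L β 0 (powScale (1 / 3) β) (9 * (L : ℝ) * (5 * (powScale (1 / 2) β * btLog β ^ 2)) + (powScale 1 β)) (min (1 / 40) (powScale (1 / 2) β * btLog β)) ((powScale 1 β) * Fintype.card (Site 3 L)) (powScale (1 / 2) β) + coreEps1 L β 0 (9 * (L : ℝ) * (5 * (powScale (1 / 2) β * btLog β ^ 2)) + (powScale 1 β)) (min (1 / 40) (powScale (1 / 2) β * btLog β)) + coreEps2 L β 0 (9 * (L : ℝ) * (5 * (powScale (1 / 2) β * btLog β ^ 2)) + (powScale 1 β)) (min (1 / 40) (powScale (1 / 2) β * btLog β)) (powScale (1 / 2) β)) *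
          (1 * (Real.exp (2 * β) ^ Fintype.card (Edge 3 L) * ((2 * π ^ 2)⁻¹) ^ Fintype.card (Edge 3 L) * Real.exp (2000 * Fintype.card (Plaquette 3 L) * (8 * (9 * (L : ℝ) * (5 * (powScale (1 / 2) β * btLog β ^ 2)) + (powScale 1 β))) ^ 3 * β) *
                Real.exp (8 * Fintype.card (Edge 3 L) * β * (8 * (9 * (L : ℝ) * (5 * (powScale (1 / 2) β * btLog β ^ 2)) + (powScale 1 β))) ^ 4) * (fpZ (powScale 1 β) * (1:ℝ) * (Real.exp (((96 * (β / 2) + (β)) * (B * (powScale 1 β * btLog β ^ 3) + MT * (powScale 1 β * btLog β ^ 3) ^ 2) * (2 * (Real.sqrt ((Fintype.card (Edge 3 L) : ℝ)) * (8 * (9 * (L : ℝ) * (5 * (powScale (1 / 2) β * btLog β ^ 2)) + (powScale 1 β))) + (7 * ((Fintype.card (Edge 3 L) : ℝ)) * (8 * (9 * (L : ℝ) * (5 * (powScale (1 / 2) β * btLog β ^ 2)) + (powScale 1 β))) + B * (9 * Ksp * (8 * (9 * (L : ℝ) * (5 * (powScale (1 / 2) β * btLog β ^ 2)) + (powScale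 1 β)))) + MT * (9 * Ksp * (8 * (9 * (L : ℝ) * (5 * (powScale (1 / 2) β * btLog β ^ 2)) + (powScale 1 β)))) ^ 2)) + (B * (powScale 1 β * btLog β ^ 3) + MT * (powScale 1 β * btLog β ^ 3) ^ 2))) + ((96 * (β / 2) + (β)) * ((CL * ((4 + 48 * Ksp) * (8 * (9 * (L : ℝ) * (5 * (powScale (1 / 2) β * btLog β ^ 2)) + (powScale 1 β)))) * (9 * Ksp * (8 * (9 * (L : ℝ) * (5 * (powScale (1 / 2) β * btLog β ^ 2)) + (powScale 1 β)))) + MT * (9 * Ksp * (8 * (9 * (L : ℝ) * (5 * (powScale (1 / 2) β * btLog β ^ 2)) + (powScale 1 β)))) ^ 2) * (2 * (Real.sqrt ((Fintype.card (Edge 3 L) : ℝ)) * (8 * (9 * (L : ℝ) * (5 * (powScale (1 / 2) β * btLog β ^ 2)) + (powScale 1 β))) + (7 * ((Fintype.card (Edge 3 L) : ℝ)) * (8 * (9 * (L : ℝ) * (5 * (powScale (1 / 2) β * btLog β ^ 2)) + (powScale 1 β))) + B * (9 * Ksp * (8 * (9 * (L : ℝ) * (5 * (powScale (1 / 2) β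 * btLog β ^ 2)) + (powScale 1 β)))) + MT * (9 * Ksp * (8 * (9 * (L : ℝ) * (5 * (powScale (1 / 2) β * btLog β ^ 2)) + (powScale 1 β)))) ^ 2)) + (CL * ((4 + 48 * Ksp) * (8 * (9 * (L : ℝ) * (5 * (powScale (1 / 2) β * btLog β ^ 2)) + (powScale 1 β)))) * (9 * Ksp * (8 * (9 * (L : ℝ) * (5 * (powScale (1 / 2) β * btLog β ^ 2)) + (powScale 1 β)))) + MT * (9 * Ksp * (8 * (9 * (L : ℝ) * (5 * (powScale (1 / 2) β * btLog β ^ 2)) + (powScale 1 β)))) ^ 2)) + 72 * ((Fintype.card (Edge 3 L) : ℝ)) * (8 * (9 * (L : ℝ) * (5 * (powScale (1 / 2) β * btLog β ^ 2)) + (powScale 1 β))) ^ 3))) * (fpWeightBar L (powScale 1 β) * (1 + Cp * (1 * powScale (1 / 4) β) ^ 2)) + ((1 + KD * ((4 + 48 * Ksp) * (8 * (9 * (L : ℝ) * (5 * (powScale (1 / 2) β * btLog β ^ 2)) + (powScale 1 β)))) ^ 2) * (4 : ℝ) ^ (flatDim L / 2 : ℝ) * Real.exp (-((1 / (4 * sliceConst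 L)) ^ 2 * (powScale 1 β * btLog β ^ 3) ^ 2 / (4 * (powScale 1 β) ^ 2))) * fpWeightBar L (powScale 1 β)) * Real.exp ((96 * (β / 2) + (β)) * (Real.sqrt ((Fintype.card (Edge 3 L) : ℝ)) * (8 * (9 * (L : ℝ) * (5 * (powScale (1 / 2) β * btLog β ^ 2)) + (powScale 1 β)))) ^ 2))) * Real.exp (882 * β * (9 * (L : ℝ) * (5 * (powScale (1 / 2) β * btLog β ^ 2)) + (powScale 1 β)) ^ 2 * ((min (1 / 40) (powScale (1 / 2) β * btLog β)) / 12) ^ 2) +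
              (1:ℝ) * (1:ℝ) * 1 * (Real.exp (2 * β) ^ Fintype.card (Edge 3 L) * Real.exp (-(β * (8 * (9 * (L : ℝ) * (5 * (powScale (1 / 2) β * btLog β ^ 2)) + (powScale 1 β))) ^ 2 / 4))) * Real.exp (49 * β * ((min (1 / 40) (powScale (1 / 2) β * btLog β)) / 12) ^ 2) / stiffGaussTop L (β / 2) β))) / (Real.exp (2 * β) ^ Fintype.card (Edge 3 L) * ((2 * π ^ 2)⁻¹) ^ Fintype.card (Edge 3 L) * fpZ (powScale 1 β) * fpWeightBar L (powScale 1 β)) - (Real.exp (-(coreEta L β 0 (powScale (1 / 3) β) (9 * (L : ℝ) * (5 * (powScale (1 / 2) β * btLog β ^ 2)) + (powScale 1 β)) (min (1 / 40) (powScale (1 / 2) β * btLog β)) ((powScale 1 β) * Fintype.card (Site 3 L)) (powScale (1 / 2) β) + coreEps1 L β 0 (9 * (L : ℝ) * (5 * (powScale (1 / 2) β * btLog β ^ 2)) + (powScale 1 β)) (min (1 / 40) (powScale (1 / 2) β * btLog β)) + coreEps2 L β 0 (9 * (L : ℝ) * (5 * (powScale (1 / 2) β * btLog β ^ 2)) +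 (powScale 1 β)) (min (1 / 40) (powScale (1 / 2) β * btLog β)) (powScale (1 / 2) β))) *
          (1 * (Real.exp (2 * β) ^ Fintype.card (Edge 3 L) * ((2 * π ^ 2)⁻¹ * ((1 + (8 * (9 * (L : ℝ) * (5 * (powScale (1 / 2) β * btLog β ^ 2)) + (powScale 1 β))) ^ 2)⁻¹) ^ 2) ^ Fintype.card (Edge 3 L) *
              Real.exp (-(2000 * Fintype.card (Plaquette 3 L) * (8 * (9 * (L : ℝ) * (5 * (powScale (1 / 2) β * btLog β ^ 2)) + (powScale 1 β))) ^ 3 * β)) * (fpZ (powScale 1 β) * ((1:ℝ) * Real.exp (-(((96 * (β / 2) + (β)) * (B * (powScale 1 β * btLog β ^ 3) + MT * (powScale 1 β * btLog β ^ 3) ^ 2) * (2 * ((((min (1 / 40) (powScale (1 / 2) β * btLog β)) / 12) + (9 / 10 * (min (1 / 40) (powScale (1 / 2) β * btLog β)))) + 14 * ((Fintype.card (Edge 3 L) : ℝ)) * (8 * (9 * (L : ℝ) * (5 * (powScale (1 / 2) β * btLog β ^ 2)) + (powScale 1 β))) ^ 2 + (CL * ((4 + 48 * Ksp) * (8 *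 (9 * (L : ℝ) * (5 * (powScale (1 / 2) β * btLog β ^ 2)) + (powScale 1 β)))) * (9 * Ksp * (8 * (9 * (L : ℝ) * (5 * (powScale (1 / 2) β * btLog β ^ 2)) + (powScale 1 β)))) + MT * (9 * Ksp * (8 * (9 * (L : ℝ) * (5 * (powScale (1 / 2) β * btLog β ^ 2)) + (powScale 1 β)))) ^ 2)) + (B * (powScale 1 β * btLog β ^ 3) + MT * (powScale 1 β * btLog β ^ 3) ^ 2))) + ((96 * (β / 2) + (β)) * ((CL * ((4 + 48 * Ksp) * (8 * (9 * (L : ℝ) * (5 * (powScale (1 / 2) β * btLog β ^ 2)) + (powScale 1 β)))) * (9 * Ksp * (8 * (9 * (L : ℝ) * (5 * (powScale (1 / 2) β * btLog β ^ 2)) + (powScale 1 β)))) + MT * (9 * Ksp * (8 * (9 * (L : ℝ) * (5 * (powScale (1 / 2) β * btLog β ^ 2)) + (powScale 1 β)))) ^ 2) * (2 * ((((min (1 / 40) (powScale (1 / 2) β * btLog β)) / 12) + (9 / 10 * (min (1 / 40) (powScale (1 / 2) β * btLog β)))) + 14 * ((Fintype.card (Edge 3 L) : ℝ)) * (8 *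 (9 * (L : ℝ) * (5 * (powScale (1 / 2) β * btLog β ^ 2)) + (powScale 1 β))) ^ 2 + (CL * ((4 + 48 * Ksp) * (8 * (9 * (L : ℝ) * (5 * (powScale (1 / 2) β * btLog β ^ 2)) + (powScale 1 β)))) * (9 * Ksp * (8 * (9 * (L : ℝ) * (5 * (powScale (1 / 2) β * btLog β ^ 2)) + (powScale 1 β)))) + MT * (9 * Ksp * (8 * (9 * (L : ℝ) * (5 * (powScale (1 / 2) β * btLog β ^ 2)) + (powScale 1 β)))) ^ 2)) + (CL * ((4 + 48 * Ksp) * (8 * (9 * (L : ℝ) * (5 * (powScale (1 / 2) β * btLog β ^ 2)) + (powScale 1 β)))) * (9 * Ksp * (8 * (9 * (L : ℝ) * (5 * (powScale (1 / 2) β * btLog β ^ 2)) + (powScale 1 β)))) + MT * (9 * Ksp * (8 * (9 * (L : ℝ) * (5 * (powScale (1 / 2) β * btLog β ^ 2)) + (powScale 1 β)))) ^ 2)) + 72 * ((Fintype.card (Edge 3 L) : ℝ)) * (8 * (9 * (L : ℝ) * (5 * (powScale (1 / 2) β * btLog β ^ 2)) + (powScale 1 β))) ^ 3)))) * ((fpWeightBar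 L (powScale 1 β) * (1 - Cp * (1 * powScale (1 / 4) β) ^ 2)) - ((1 + KD * ((4 + 48 * Ksp) * (8 * (9 * (L : ℝ) * (5 * (powScale (1 / 2) β * btLog β ^ 2)) + (powScale 1 β)))) ^ 2) * (4 : ℝ) ^ (flatDim L / 2 : ℝ) * Real.exp (-((1 / (4 * sliceConst L)) ^ 2 * (powScale 1 β * btLog β ^ 3) ^ 2 / (4 * (powScale 1 β) ^ 2))) * fpWeightBar L (powScale 1 β))))) *
            (Real.exp (-(882 * β * (9 * (L : ℝ) * (5 * (powScale (1 / 2) β * btLog β ^ 2)) + (powScale 1 β)) ^ 2 * ((min (1 / 40) (powScale (1 / 2) β * btLog β)) / 12) ^ 2)) -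
              Real.exp (49 * β * ((min (1 / 40) (powScale (1 / 2) β * btLog β)) / 12) ^ 2) * (Real.exp (-(β * (min ((8 * (9 * (L : ℝ) * (5 * (powScale (1 / 2) β * btLog β ^ 2)) + (powScale 1 β))) - 2 * (9 * (L : ℝ) * (5 * (powScale (1 / 2) β * btLog β ^ 2)) + (powScale 1 β))) ((9 / 10 * (min (1 / 40) (powScale (1 / 2) β * btLog β))) - 6 * (9 * (L : ℝ) * (5 * (powScale (1 / 2) β * btLog β ^ 2)) + (powScale 1 β)) ^ 2 * ((min (1 / 40) (powScale (1 / 2) β * btLog β)) / 12))) ^ 2 / 2)) * (π / (β / 2)) ^ ((Module.finrank ℝ (LinkSpace L) : ℝ) / 2)) /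
                stiffGaussTop L (β / 2) β)))) / (Real.exp (2 * β) ^ Fintype.card (Edge 3 L) * ((2 * π ^ 2)⁻¹) ^ Fintype.card (Edge 3 L) * fpZ (powScale 1 β) * fpWeightBar L (powScale 1 β))) * powScale (-(1 / 5)) β < 1 / 2 := hd.eventually (Iio_mem_nhds (by norm_num))
  filter_upwards [hev1, hev2] with β h1 h2
  exact ratio_rate_of_weighted (hNpos β) h1 h2 (powScale_fifth_mul_weight β) (powScale_pos _ _)

-- (g20, 2026-08-29T12:5xZ) comment-only touch re-land: the hub olean of this module was missing > 2 h after acceptance (p712045,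
-- accepted in the 08:30–10:0x dispatch-stall window); no declaration changed.

end Summit.QuantumFields.YangMills.Theorems.FemtoTransferGap.TwoLattice.ConstTube
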